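import Summits.BirchSwinnertonDyer.Rank1Residual.Additive.StrictSignedLocalPreimageCard
import Summits.BirchSwinnertonDyer.Rank1Residual.Additive.StrictSignedSelmerLayerZero
import Summits.BirchSwinnertonDyer.Rank1Residual.Additive.StrictSelmerDominatesSha
import Literature.NumberTheory.EllipticCurves.Kobayashi2003.SignedSelmerRankBoundProofs
import Literature.NumberTheory.EllipticCurves.KatoRankBoundSelmerProofs
import HarnessLib

/-!
# The EVEN (`ε = +1`) bottom layer: `#Sel⁺(W/ℚ_0) = #Sel_{p^∞}(W/ℚ)` and the exact identity
# `ord_p #Sel_{p^∞}(W/ℚ) + ord_p #(Sel^{loc,∞,+}(W/ℚ) ⧸ Sel⁺(W/ℚ_0)) = ord_p f⁺(0)` for the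
# `p*`-twist of a good `a_p = 0` curve (cell `bsd-potss`, seat `bsd-potss-ctrl` g2; target T-e2-r0
# of `HOME/TARGET.md` §1.1 = the rank-ZERO twin of (C3_η) at the bottom layer `n = 0`)

HONEST FRAMING (cell `bsd-potss`, run/shared/lean/pub/bsd-potss/; FULL-BSD rank ≤ 1 programme,
tranche 1b): the cell's object on Gss2 (`e = 2`) is the EXACT CONTROL of Kobayashi's signed Selmer
groups along the quadratic branch `η = ω^{(p−1)/2}`. This file is the `ε = +1`, `n = 0` instance of
x1b's `ε`-generic `W`-coordinate control machinery (`StrictSignedControlZero.*`, GEN 34–36, 44),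
read in the tree's classical currency: TOOL THEOREMS ONLY — no definition, no named Literature fact,
no Summits-side fact `def … : Prop`, no `sorry`, axioms standard; the Iwasawa-side inputs (a
Pontryagin-dual datum `D` of `Sel⁺(W/ℚ_∞)` with `X` torsion, `char = (f)`, `f(0) ≠ 0`, no finite
`Λ`-submodule — i.e. (C1_η) read on `D` and Kitajima–Otsuki sign `+`) are DISPLAYED HYPOTHESES;
nothing is booked; no label / mark / count / sub-cell moves; (C1_η) stays a typed conjecture;
Gss2 / O5a / O10-PS stay OPEN; nothing about `BSD(W, p)` of any pair is claimed.

## What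

For an odd prime `p`, `W/ℚ` the `p*`-twist of a globally minimal `V` with good reduction at `p` and
`a_p(V) = 0` (`C • W.quadraticTwist ((−1)^{p/2} p) = V`), `κ` a `ℤ_p`-extension of `ℚ` with
topological generator `γ`, and `D : StrictSignedSelmerDualData W κ ℚ_[p] γ 1` — the Pontryagin dual
`X⁺` of Kobayashi's PLUS Selmer group `Sel⁺(W/ℚ_∞)` in `W`-coordinates (Def. 2.1 carries NO extra
clause on the even side: `strictSignedLocalPointsOfEmb_one`):

* §1 `StrictSignedLayerZero.natCard_strictSignedSelmerLayer_one_zero_eq` (any `K`, `κ`, model `E`):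
  **`#Sel⁺(E/K_0) = #(Sel_{p^∞}(E/K) ⊓ selmerLocalKerPrimary W E p)`** — Kobayashi's "`E⁺(F_{0,p}) =
  E(ℚ_p)`" (Def. 1.1 at `n = 0`, `signedLocalPointsOfEmb_zero`): the plus Kummer condition at the
  bottom layer is cut out by ALL of `E(E)`, i.e. it is the classical local condition at the model `E`
  (`localKummerOverOfEmb_fixedPoints_eq`); for `K = ℚ`, `E = ℚ_[p]` the intersection is redundant
  (`StrictSha.selmerGroupPInfty_le_selmerLocalKerPrimary_padic`):
  **`#Sel⁺(W/ℚ_0) = #Sel_{p^∞}(W/ℚ)`** (`…_eq_selmerGroupPInfty`).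
* §2 `EvenControlZero.finite_and_padicValNat_card_selmerGroupPInfty_add_eq` (`W/ℚ`, any `κ`, `γ`,
  `W(ℚ_∞)[p^∞] = 0`): **`Sel_{p^∞}(W/ℚ)` is finite and
  `ord_p #Sel_{p^∞}(W/ℚ) + ord_p #(A₀⁺ ⧸ Sel⁺(W/ℚ_0)) = ord_p f(0)`**, `A₀⁺ = h₀⁻¹(Sel⁺(W/ℚ_∞))` —
  x1b's file 42 at `ε = +1`; and `…_of_quadraticTwist_signedPrime`: for the `p*`-twist `W` of a good
  `a_p = 0` curve the same with `A₀⁺` written as `Sel^{loc,∞,+}(W/ℚ)` (the classes over `ℚ` whose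
  restriction to `ℚ_∞` satisfies the LEVEL-`∞` conditions: classical everywhere, plus-Kummer at
  `ℚ_[p]`) and with `W(ℚ_∞)[p^∞] = 0`, `W(ℚ_{p,∞})[p^∞] = 0` DISCHARGED (x1b GEN 36 file 55), plus
  `#Sel^{loc,∞,+}(W/ℚ) = p^{ord_p f(0)}` (file 57 at `ε = +1`).
* §3 Corollaries: `ord_p #Sel_{p^∞}(W/ℚ) ≤ ord_p f(0)` (the Kato-direction half, control injectivity
  only) and the unit case `f(0) ∈ ℤ_p^× ⟹ Sel_{p^∞}(W/ℚ) = 0`.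

What is NOT here (the successor files of this seat): the COUNT of the defect
`A₀⁺ ⧸ Sel⁺(W/ℚ_0)` — `= ∏_{ℓ ≠ p} c_ℓ(W)^{(p)}`, with NO contribution at `p` by Kobayashi's (9.33)
(the level-`∞` plus condition pulls back to the classical one at the bottom layer) — which turns §2
into B.D. Kim's Euler-characteristic formula on the `η`-branch, and the readings (C1_η) ↦ `D`.

References: [Kobayashi2003] S. Kobayashi, Invent. Math. 152 (2003), Def. 1.1 (p. 2), Def. 2.1 (p. 5),
Lemma 9.1 (p. 25), Prop. 9.2 and Thm. 9.3 with (9.33) (p. 26); [GreenbergLNM1716] R. Greenberg, LNM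
1716 (1999), §3 Lemma 3.1–3.3, §4 Thm. 4.1 and Lemma 4.2 (p. 102); [Kim2013] B. D. Kim, *The plus/minus
Selmer groups for supersingular primes*, J. Aust. Math. Soc. 95 (2013) 189–200, Thm. 1.1 (shape of
the target formula; nothing asserted); [KitajimaOtsuki2018] Main Thm. 1.3 (sign `+`; displayed).
-/

noncomputable section

open scoped Classical

universe u

namespace Summit.BirchSwinnertonDyer.Rank1Residual.Additive

open WeierstrassCurve Literature.NumberTheory Literature.NumberTheory.EllipticCurves
  Literature.NumberTheory.GaloisRepresentations
  Literature.NumberTheory.EllipticCurves.IwasawaAlgebra Literature.NumberTheory.EllipticCurves.IwasawaDual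
  Literature.NumberTheory.EllipticCurves.Kobayashi2003 ZpExtension

namespace StrictSignedLayerZero

/-! ## §1 The bottom layer of the plus structure is the classical Selmer group -/

section LayerZero

variable {K : Type u} [Field K] [NumberField K] (W : WeierstrassCurve K) (p : ℕ) [Fact p.Prime]
  (E : Type u) [Field E] [Algebra K E]

omit [Fact p.Prime] in
/-- **Selmer group plus the FULL Kummer condition at a model `E`, over `H = ⊤`, counted in
`H¹(K, E[p^∞])`.** The subgroup of `H¹(⊤, E[p^∞])` cut out by the Selmer conditions
(`selmerGroupOver p ⊤`) and Kobayashi's Kummer condition for ALL of `E(E) = E(K̄_E)^{Γ_E}` at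
`closureEmb E` and its `Γ_K`-conjugates has the cardinality of
`Sel_{p^∞}(E/K) ⊓ selmerLocalKerPrimary W E p`: transport along the bijective `res`
(`bijective_resH1Hom_subgroupIncl`), the Selmer part by
`resH1Hom_subgroupIncl_mem_selmerGroupOver_top_iff`, the Kummer part because the Kummer condition
cut out by all of `E(E)` IS the classical local kernel (`localKummerOverOfEmb_fixedPoints_eq`,
`resH1Hom_subgroupIncl_mem_localKerOver_top_iff`), conjugations being trivial on `H¹(⊤, ·)`.
[cite: Kobayashi2003, Def. 1.1 (p. 2: `E^±(F_{0,p}) = E(ℚ_p)`)] [cite: GreenbergLNM1716, §2] -/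
theorem natCard_selmerGroupOver_inf_localKummer_fixedPoints_eq
    (H : Subgroup (Field.absoluteGaloisGroup K)) [H.Normal] (hH : H = ⊤) :
    Nat.card ↥(W.selmerGroupOver p H ⊓
        ⨅ σ : Field.absoluteGaloisGroup K,
          (localKummerOverOfEmb W p H (closureEmb (K := K) E)
            (FixedPoints.addSubgroup (localSubgroupOfEmb H (closureEmb (K := K) E))
              (localPoints W E))).comap (W.conjH1 p H σ)) =
      Nat.card ↥(W.selmerGroupPInfty p ⊓ selmerLocalKerPrimary W E p) := by
  subst hH
  haveI : CompactSpace (Field.absoluteGaloisGroup K) := compactSpace_absoluteGaloisGroup K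
  haveI : CompactSpace (⊤ : Subgroup (Field.absoluteGaloisGroup K)) :=
    isCompact_iff_compactSpace.mp (by rw [Subgroup.coe_top]; exact isCompact_univ)
  set res := resH1Hom (subgroupIncl (⊤ : Subgroup (Field.absoluteGaloisGroup K)))
    (AddMonoidHom.id (W.geomPrimaryTorsion p)) (fun _ _ ↦ rfl) with hres
  have hbij : Function.Bijective res := bijective_resH1Hom_subgroupIncl _ ⊤ Subgroup.mem_top
  let e : W.galH1Primary p ≃+ W.subgroupH1 p (⊤ : Subgroup (Field.absoluteGaloisGroup K)) :=
    AddEquiv.ofBijective res hbij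
  have hconj : ∀ (σ : Field.absoluteGaloisGroup K) (c : W.galH1Primary p),
      W.conjH1 p ⊤ σ (res c) = res c := fun σ c ↦ by
    rw [W.conjH1_of_mem_holds p ⊤ (Subgroup.mem_top σ), AddMonoidHom.id_apply]
  have hmem : ∀ c : W.galH1Primary p,
      res c ∈ (W.selmerGroupOver p ⊤ ⊓ ⨅ σ : Field.absoluteGaloisGroup K,
          (localKummerOverOfEmb W p ⊤ (closureEmb (K := K) E)
            (FixedPoints.addSubgroup (localSubgroupOfEmb ⊤ (closureEmb (K := K) E))
              (localPoints W E))).comap (W.conjH1 p ⊤ σ)) ↔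
        c ∈ W.selmerGroupPInfty p ⊓ selmerLocalKerPrimary W E p := fun c ↦ by
    rw [AddSubgroup.mem_inf, AddSubgroup.mem_inf, AddSubgroup.mem_iInf,
      W.resH1Hom_subgroupIncl_mem_selmerGroupOver_top_iff p c]
    simp only [AddSubgroup.mem_comap, hconj, forall_const]
    rw [localKummerOverOfEmb_fixedPoints_eq, ← localKerOver_eq_ofEmb,
      W.resH1Hom_subgroupIncl_mem_localKerOver_top_iff p c]
  have hmap : (W.selmerGroupPInfty p ⊓ selmerLocalKerPrimary W E p).map
      (e : W.galH1Primary p →+ W.subgroupH1 p ⊤) =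
      W.selmerGroupOver p ⊤ ⊓ ⨅ σ : Field.absoluteGaloisGroup K,
        (localKummerOverOfEmb W p ⊤ (closureEmb (K := K) E)
          (FixedPoints.addSubgroup (localSubgroupOfEmb ⊤ (closureEmb (K := K) E))
            (localPoints W E))).comap (W.conjH1 p ⊤ σ) := by
    ext d
    constructor
    · rintro ⟨c, hc, rfl⟩
      exact (hmem c).mpr hc
    · intro hd
      obtain ⟨c, rfl⟩ := hbij.2 d
      exact ⟨c, (hmem c).mp hd, rfl⟩
  exact (Nat.card_congr ((e.addSubgroupMap _).trans (AddEquiv.addSubgroupCongr hmap)).toEquiv).symm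

variable {p} (κ : ZpExtension K p)

/-- **The bottom layer of the PLUS structure is the classical Selmer group (model `E`):
`#Sel⁺(E/K_0) = #(Sel_{p^∞}(E/K) ⊓ selmerLocalKerPrimary W E p)`** — Def. 2.1 has no extra clause on
the even side (`strictSignedLocalPointsOfEmb_one`), Def. 1.1 is empty at `n = 0`
(`signedLocalPointsOfEmb_zero`: `E⁺(K_0·E) = E(E)`), `κ⁻¹(p⁰ℤ_p) = ⊤` (`layerSubgroup_zero`), and
`natCard_selmerGroupOver_inf_localKummer_fixedPoints_eq`. [cite: Kobayashi2003, Def. 1.1 (p. 2) and Def. 2.1 (p. 5)] -/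
theorem natCard_strictSignedSelmerLayer_one_zero_eq :
    Nat.card ↥(strictSignedSelmerLayer W κ E 1 0) =
      Nat.card ↥(W.selmerGroupPInfty p ⊓ selmerLocalKerPrimary W E p) := by
  have h1 : strictSignedLocalPoints κ E W 1 0 =
      FixedPoints.addSubgroup (localSubgroupOfEmb (κ.layerSubgroup 0) (closureEmb (K := K) E))
        (localPoints W E) := by
    rw [strictSignedLocalPoints, strictSignedLocalPointsOfEmb_one, signedLocalPointsOfEmb_zero]
    rfl
  rw [strictSignedSelmerLayer, h1]
  exact natCard_selmerGroupOver_inf_localKummer_fixedPoints_eq W p E (κ.layerSubgroup 0)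
    κ.layerSubgroup_zero

end LayerZero

/-! ## §1b Over `ℚ` with `E = ℚ_[p]`: `#Sel⁺(W/ℚ_0) = #Sel_{p^∞}(W/ℚ)` -/

section Rat

variable (W : WeierstrassCurve ℚ) [W.IsElliptic] {p : ℕ} [Fact p.Prime] (κ : ZpExtension ℚ p)

omit [W.IsElliptic] in
/-- **`#Sel⁺(W/ℚ_0) = #Sel_{p^∞}(W/ℚ)`**: for `K = ℚ`, `E = ℚ_[p]` the local kernel at `ℚ_[p]`
CONTAINS the Selmer group (`StrictSha.selmerGroupPInfty_le_selmerLocalKerPrimary_padic`: the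
Selmer condition at the place `p` transported to Mathlib's model `ℚ_[p]`), so the intersection in
`natCard_strictSignedSelmerLayer_one_zero_eq` is the Selmer group itself.
[cite: Kobayashi2003, Def. 1.1 (p. 2: `E^±(F_{0,p}) = E(ℚ_p)`)] [cite: GreenbergLNM1716, §2] -/
theorem natCard_strictSignedSelmerLayer_one_zero_eq_selmerGroupPInfty :
    Nat.card ↥(strictSignedSelmerLayer W κ ℚ_[p] 1 0) = Nat.card ↥(W.selmerGroupPInfty p) := by
  rw [natCard_strictSignedSelmerLayer_one_zero_eq W ℚ_[p] κ,
    inf_of_le_left (StrictSha.selmerGroupPInfty_le_selmerLocalKerPrimary_padic W p)]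

end Rat

end StrictSignedLayerZero

/-! ## §2 The exact even bottom-layer identity in the classical currency -/

namespace EvenControlZero

variable (W : WeierstrassCurve ℚ) [W.IsElliptic] {p : ℕ} [hp : Fact p.Prime] (κ : ZpExtension ℚ p)
  {γ : Field.absoluteGaloisGroup ℚ}

omit [W.IsElliptic] in
/-- **The even bottom-layer IDENTITY, `h₀`-preimage form.** For `W/ℚ`, a `ℤ_p`-extension `κ` with
topological generator `γ`, a Pontryagin-dual datum `D` of the PLUS Selmer group `Sel⁺(W/ℚ_∞)`
(model `ℚ_[p]`) with `X` finitely generated torsion, `char(X) = (f)`, `f(0) ≠ 0`, NO non-trivial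
finite `Λ`-submodule, and `W(ℚ_∞)[p^∞] = 0`: `Sel_{p^∞}(W/ℚ)` and `A₀⁺ ⧸ Sel⁺(W/ℚ_0)`
(`A₀⁺ = h₀⁻¹(Sel⁺(W/ℚ_∞))`) are finite and
**`ord_p #Sel_{p^∞}(W/ℚ) + ord_p #(A₀⁺ ⧸ Sel⁺(W/ℚ_0)) = ord_p f(0)`** — x1b's file 42
(`StrictSignedControlZero.finite_and_padicValNat_card_add_eq`) at `ε = +1`, read on `Sel_{p^∞}(W/ℚ)`
by §1b. With (C1_η) READ on `D` (`f = L_p⁺(V, η, X)` up to a unit) and Kitajima–Otsuki (sign `+`),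
this is the rank-zero twin of (C3_η) once the defect is counted.
[cite: Kobayashi2003, Lemma 9.1 (p. 25), Thm. 9.3 (p. 26)] [cite: GreenbergLNM1716, §3 Lemma 3.2, §4 Lemma 4.2 (p. 102)] -/
theorem finite_and_padicValNat_card_selmerGroupPInfty_add_eq (hγ : κ.IsTopGenerator γ)
    (D : StrictSignedSelmerDualData W κ ℚ_[p] γ 1)
    [Module.Finite (IwasawaAlgebra p) D.X] (hX : Module.IsTorsion (IwasawaAlgebra p) D.X)
    (hB : FixedPoints.addSubgroup κ.kerSubgroup (W.geomPrimaryTorsion p) = ⊥)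
    (hnf : ∀ N : Submodule (IwasawaAlgebra p) D.X, Finite N → N = ⊥)
    {f : IwasawaAlgebra p} (hf : D.charIdeal = Ideal.span {f})
    (h0 : PowerSeries.constantCoeff f ≠ 0) :
    Finite ↥(W.selmerGroupPInfty p) ∧
      Finite (↥((strictSignedSelmerInfty W κ ℚ_[p] 1).comap (W.layerToInfty κ 0)) ⧸
        (strictSignedSelmerLayer W κ ℚ_[p] 1 0).addSubgroupOf
          ((strictSignedSelmerInfty W κ ℚ_[p] 1).comap (W.layerToInfty κ 0))) ∧
      (padicValNat p (Nat.card ↥(W.selmerGroupPInfty p)) : ℤ) +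
          padicValNat p (Nat.card (↥((strictSignedSelmerInfty W κ ℚ_[p] 1).comap (W.layerToInfty κ 0)) ⧸
            (strictSignedSelmerLayer W κ ℚ_[p] 1 0).addSubgroupOf
              ((strictSignedSelmerInfty W κ ℚ_[p] 1).comap (W.layerToInfty κ 0)))) =
        ((PowerSeries.constantCoeff f : ℤ_[p]) : ℚ_[p]).valuation := by
  obtain ⟨hfin, hfinQ, heq⟩ :=
    StrictSignedControlZero.finite_and_padicValNat_card_add_eq W κ ℚ_[p] 1 hγ D hX hB hnf hf h0
  have hcard := StrictSignedLayerZero.natCard_strictSignedSelmerLayer_one_zero_eq_selmerGroupPInfty W κ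
  haveI := hfin
  have hpos : 0 < Nat.card ↥(strictSignedSelmerLayer W κ ℚ_[p] 1 0) := Nat.card_pos
  refine ⟨Nat.finite_of_card_ne_zero (by rw [← hcard]; exact hpos.ne'), hfinQ, ?_⟩
  rw [← hcard]
  exact heq

/-- **The even bottom-layer IDENTITY for the `p*`-twist, local form, hypothesis-free on the
arithmetic side.** For the odd prime `p`, `W/ℚ` with `C • W.quadraticTwist ((−1)^{p/2} p) = V`, `V`
globally minimal with good reduction at `p` and `a_p(V) = 0`, `κ` a `ℤ_p`-extension with topological
generator `γ`, and a plus dual datum `D` (`X` f.g. torsion, `char = (f)`, `f(0) ≠ 0`, no finite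
`Λ`-submodule): with `Sel^{loc,∞,+}(W/ℚ)` the group of classes over `ℚ` restricting into
`Sel_{p^∞}(W/ℚ_∞)` and into the level-`∞` PLUS Kummer condition at every conjugate of the embedding
at `p`, **`Sel_{p^∞}(W/ℚ)` is finite,
`ord_p #Sel_{p^∞}(W/ℚ) + ord_p #(Sel^{loc,∞,+}(W/ℚ) ⧸ Sel⁺(W/ℚ_0)) = ord_p f(0)`, and
`#Sel^{loc,∞,+}(W/ℚ) = p^{ord_p f(0)}`** — `W(ℚ_∞)[p^∞] = 0` and `W(ℚ_{p,∞})[p^∞] = 0` discharged by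
x1b GEN 36 (file 55: Kobayashi Prop. 8.7 + Serre's degree bound, transported through the twist).
[cite: Kobayashi2003, Prop. 8.7 (p. 16), Lemma 9.1 (p. 25), Thm. 9.3 (p. 26)]
[cite: GreenbergLNM1716, §3 pp. 85–90 and §4 Thm. 4.1, Lemma 4.2 (p. 102)] -/
theorem finite_and_padicValNat_card_selmerGroupPInfty_add_eq_of_quadraticTwist_signedPrime
    (hp2 : p ≠ 2) (C : VariableChange ℚ) (V : WeierstrassCurve ℚ) [V.IsElliptic] [V.IsGloballyMinimal]
    (hCV : C • W.quadraticTwist ((-1) ^ (p / 2) * p) = V)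
    (hgood : V.HasGoodReductionAtPrime p) (hap : V.frobeniusTrace p = 0)
    (hγ : κ.IsTopGenerator γ) (D : StrictSignedSelmerDualData W κ ℚ_[p] γ 1)
    [Module.Finite (IwasawaAlgebra p) D.X] (hX : Module.IsTorsion (IwasawaAlgebra p) D.X)
    (hnf : ∀ N : Submodule (IwasawaAlgebra p) D.X, Finite N → N = ⊥)
    {f : IwasawaAlgebra p} (hf : D.charIdeal = Ideal.span {f})
    (h0 : PowerSeries.constantCoeff f ≠ 0) :
    Finite ↥(W.selmerGroupPInfty p) ∧
      Finite (↥((W.selmerInfty κ ⊓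
          ⨅ σ : Field.absoluteGaloisGroup ℚ,
            (localKummerOverOfEmb W p κ.kerSubgroup (closureEmb (K := ℚ) ℚ_[p])
                (⨆ m, strictSignedLocalPoints κ ℚ_[p] W 1 m)).comap (W.conjH1 p κ.kerSubgroup σ)).comap
          (W.layerToInfty κ 0)) ⧸
        (strictSignedSelmerLayer W κ ℚ_[p] 1 0).addSubgroupOf ((W.selmerInfty κ ⊓
          ⨅ σ : Field.absoluteGaloisGroup ℚ,
            (localKummerOverOfEmb W p κ.kerSubgroup (closureEmb (K := ℚ) ℚ_[p])
                (⨆ m, strictSignedLocalPoints κ ℚ_[p] W 1 m)).comap (W.conjH1 p κ.kerSubgroup σ)).comap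
          (W.layerToInfty κ 0))) ∧
      (padicValNat p (Nat.card ↥(W.selmerGroupPInfty p)) : ℤ) +
          padicValNat p (Nat.card (↥((W.selmerInfty κ ⊓
            ⨅ σ : Field.absoluteGaloisGroup ℚ,
              (localKummerOverOfEmb W p κ.kerSubgroup (closureEmb (K := ℚ) ℚ_[p])
                  (⨆ m, strictSignedLocalPoints κ ℚ_[p] W 1 m)).comap (W.conjH1 p κ.kerSubgroup σ)).comap
            (W.layerToInfty κ 0)) ⧸
          (strictSignedSelmerLayer W κ ℚ_[p] 1 0).addSubgroupOf ((W.selmerInfty κ ⊓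
            ⨅ σ : Field.absoluteGaloisGroup ℚ,
              (localKummerOverOfEmb W p κ.kerSubgroup (closureEmb (K := ℚ) ℚ_[p])
                  (⨆ m, strictSignedLocalPoints κ ℚ_[p] W 1 m)).comap (W.conjH1 p κ.kerSubgroup σ)).comap
            (W.layerToInfty κ 0)))) =
        ((PowerSeries.constantCoeff f : ℤ_[p]) : ℚ_[p]).valuation ∧
      Nat.card (↥((W.selmerInfty κ ⊓
          ⨅ σ : Field.absoluteGaloisGroup ℚ,
            (localKummerOverOfEmb W p κ.kerSubgroup (closureEmb (K := ℚ) ℚ_[p])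
                (⨆ m, strictSignedLocalPoints κ ℚ_[p] W 1 m)).comap (W.conjH1 p κ.kerSubgroup σ)).comap
          (W.layerToInfty κ 0))) =
        p ^ (((PowerSeries.constantCoeff f : ℤ_[p]) : ℚ_[p]).valuation).toNat := by
  obtain ⟨M, hΔ, hA, hVM⟩ := exists_goodSupersingularPadicModel hp2 V hgood hap
  obtain ⟨S, hS⟩ := exists_finset_forall_not_mem_good W p
  have hc := sq_ne_neg_one_pow_mul_prime hp.out (p / 2)
  have hB := fixedPoints_kerSubgroup_geomPrimaryTorsion_eq_bot_of_quadraticTwist κ hp2 W hc C hCV M hΔ hA hVM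
  have htors := eq_zero_of_prime_pow_smul_eq_zero_localFixedPointsOfEmb_kerSubgroup_of_quadraticTwist κ
    (closureEmb (K := ℚ) ℚ_[p]) hp2 W hc C hCV M hΔ hA hVM
  obtain ⟨hfinS, hfinQ, heq⟩ := StrictSignedControlZero.finite_and_padicValNat_card_localPreimage_add_eq
    W κ ℚ_[p] 1 hγ D hX hB hnf hf h0 S hS htors
  obtain ⟨-, -, hpow⟩ :=
    StrictSignedControlZero.finite_localPreimage_and_natCard_eq_of_quadraticTwist_signedPrime κ W 1 hp2
      C V hCV hgood hap hγ D hX hnf hf h0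
  have hcard := StrictSignedLayerZero.natCard_strictSignedSelmerLayer_one_zero_eq_selmerGroupPInfty W κ
  haveI := hfinS
  have hpos : 0 < Nat.card ↥(strictSignedSelmerLayer W κ ℚ_[p] 1 0) := Nat.card_pos
  refine ⟨Nat.finite_of_card_ne_zero (by rw [← hcard]; exact hpos.ne'), hfinQ, ?_, hpow⟩
  rw [← hcard]
  exact heq

/-! ## §3 Corollaries: the Kato-direction half and the unit case -/

/-- **`ord_p #Sel_{p^∞}(W/ℚ) ≤ ord_p f⁺(0)`** for the `p*`-twist of a good `a_p = 0` curve and any plus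
dual datum as in §2 (control injectivity only; the defect `A₀⁺ ⧸ Sel⁺(W/ℚ_0)` is a finite group whose
order is a NONNEGATIVE power of `p`). The even twin of x1b's
`StrictSignedControlZero.finite_and_padicValNat_card_strictSelmerPInfty_le`.
[cite: Kobayashi2003, Lemma 9.1 (p. 25), Thm. 9.3 (p. 26)] [cite: GreenbergLNM1716, §4 Lemma 4.2 (p. 102)] -/
theorem finite_and_padicValNat_card_selmerGroupPInfty_le_of_quadraticTwist_signedPrime
    (hp2 : p ≠ 2) (C : VariableChange ℚ) (V : WeierstrassCurve ℚ) [V.IsElliptic] [V.IsGloballyMinimal]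
    (hCV : C • W.quadraticTwist ((-1) ^ (p / 2) * p) = V)
    (hgood : V.HasGoodReductionAtPrime p) (hap : V.frobeniusTrace p = 0)
    (hγ : κ.IsTopGenerator γ) (D : StrictSignedSelmerDualData W κ ℚ_[p] γ 1)
    [Module.Finite (IwasawaAlgebra p) D.X] (hX : Module.IsTorsion (IwasawaAlgebra p) D.X)
    (hnf : ∀ N : Submodule (IwasawaAlgebra p) D.X, Finite N → N = ⊥)
    {f : IwasawaAlgebra p} (hf : D.charIdeal = Ideal.span {f})
    (h0 : PowerSeries.constantCoeff f ≠ 0) :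
    Finite ↥(W.selmerGroupPInfty p) ∧
      (padicValNat p (Nat.card ↥(W.selmerGroupPInfty p)) : ℤ) ≤
        ((PowerSeries.constantCoeff f : ℤ_[p]) : ℚ_[p]).valuation := by
  obtain ⟨hfin, -, heq, -⟩ :=
    finite_and_padicValNat_card_selmerGroupPInfty_add_eq_of_quadraticTwist_signedPrime W κ hp2 C V hCV
      hgood hap hγ D hX hnf hf h0
  refine ⟨hfin, ?_⟩
  rw [← heq]
  exact le_add_of_nonneg_right (Int.natCast_nonneg _)

/-- **The even UNIT case: `f⁺(0) ∈ ℤ_p^× ⟹ Sel_{p^∞}(W/ℚ) = 0`** (so `W(ℚ) ⊗ ℚ_p/ℤ_p = 0` and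
`Ш(W)[p^∞] = 0`): a finite `p`-group with `ord_p` of its order `≤ 0` is trivial. With (C1_η) READ on
`D` this is the per-pair even unit certificate `L_p⁺(V, η, 0) ∈ ℤ_p^× ⟹ Sel_{p^∞}(W/ℚ) = 0` of
TARGET §1.1 (it duplicates Kato's Thm. 14.5(3) unit rows in another currency; nothing booked).
[cite: Kobayashi2003, Thm. 9.3 (p. 26), (3.6) (p. 7)] [cite: GreenbergLNM1716, §4 Thm. 4.1] -/
theorem selmerGroupPInfty_eq_bot_of_isUnit_of_quadraticTwist_signedPrime
    (hp2 : p ≠ 2) (C : VariableChange ℚ) (V : WeierstrassCurve ℚ) [V.IsElliptic] [V.IsGloballyMinimal]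
    (hCV : C • W.quadraticTwist ((-1) ^ (p / 2) * p) = V)
    (hgood : V.HasGoodReductionAtPrime p) (hap : V.frobeniusTrace p = 0)
    (hγ : κ.IsTopGenerator γ) (D : StrictSignedSelmerDualData W κ ℚ_[p] γ 1)
    [Module.Finite (IwasawaAlgebra p) D.X] (hX : Module.IsTorsion (IwasawaAlgebra p) D.X)
    (hnf : ∀ N : Submodule (IwasawaAlgebra p) D.X, Finite N → N = ⊥)
    {f : IwasawaAlgebra p} (hf : D.charIdeal = Ideal.span {f})
    (hu : IsUnit (PowerSeries.constantCoeff f)) :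
    W.selmerGroupPInfty p = ⊥ := by
  have h0 : PowerSeries.constantCoeff f ≠ 0 := hu.ne_zero
  obtain ⟨hfin, hle⟩ :=
    finite_and_padicValNat_card_selmerGroupPInfty_le_of_quadraticTwist_signedPrime W κ hp2 C V hCV
      hgood hap hγ D hX hnf hf h0
  haveI := hfin
  -- the valuation of a unit is `0`
  have hval : ((PowerSeries.constantCoeff f : ℤ_[p]) : ℚ_[p]).valuation = 0 := by
    obtain ⟨u, hu'⟩ := hu
    rw [← hu']
    have h1 : ‖((u : ℤ_[p]) : ℚ_[p])‖ = 1 := by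
      rw [PadicInt.padic_norm_e_of_padicInt]; exact PadicInt.isUnit_iff.mp u.isUnit
    have hne : ((u : ℤ_[p]) : ℚ_[p]) ≠ 0 := by
      intro h; rw [h, norm_zero] at h1; exact zero_ne_one h1
    have h2 := Padic.norm_eq_zpow_neg_valuation hne
    rw [h1] at h2
    have h3 : ((p : ℝ) ^ (-((u : ℤ_[p]) : ℚ_[p]).valuation)) = (p : ℝ) ^ (0 : ℤ) := by
      rw [zpow_zero]; exact h2.symm
    have hp1 : 1 < (p : ℝ) := by exact_mod_cast hp.out.one_lt
    have := zpow_right_injective₀ (by positivity) hp1.ne' h3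
    omega
  rw [hval] at hle
  -- `Sel` is a finite `p`-group (`p`-primary cohomology classes) of order `p^k` with `k ≤ 0`
  have hprim : ∀ s : W.selmerGroupPInfty p, ∃ k : ℕ, p ^ k • s = 0 := fun s ↦ by
    obtain ⟨k, hk⟩ := W.exists_pow_smul_galH1Primary_eq_zero (s : W.galH1Primary p)
    exact ⟨k, Subtype.ext (by rw [AddSubgroupClass.coe_nsmul, hk, ZeroMemClass.coe_zero])⟩
  have hG : IsPGroup p (Multiplicative (W.selmerGroupPInfty p)) := fun x ↦ by
    obtain ⟨k, hk⟩ := hprim (Multiplicative.toAdd x)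
    refine ⟨k, ?_⟩
    apply Multiplicative.toAdd.injective
    rw [toAdd_pow, toAdd_one, hk]
  obtain ⟨k, hk⟩ := IsPGroup.iff_card.mp hG
  have hcardk : Nat.card (W.selmerGroupPInfty p) = p ^ k := by
    rw [← hk]; exact (Nat.card_congr Multiplicative.toAdd).symm
  rw [hcardk, padicValNat.prime_pow] at hle
  have hk0 : k = 0 := by omega
  rw [hk0, pow_zero] at hcardk
  exact AddSubgroup.eq_bot_of_card_eq (W.selmerGroupPInfty p) hcardk

end EvenControlZero

end Summit.BirchSwinnertonDyer.Rank1Residual.Additive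

end
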